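import Summits.CriticalPhenomena.PercolationContinuityZ3.Theorems.Transplant.SkelFrmQuasiBParamsLF
import Summits.CriticalPhenomena.PercolationContinuityZ3.Theorems.Transplant.SkelFrmBParamsLF
import Summits.CriticalPhenomena.PercolationContinuityZ3.Theorems.Transplant.SkelNegBParamsLF
import Summits.CriticalPhenomena.PercolationContinuityZ3.Theorems.Transplant.SkelNegParamsFineMultA
import Summits.CriticalPhenomena.PercolationContinuityZ3.Theorems.Transplant.SkelNegParamsFineA
import Summits.CriticalPhenomena.PercolationContinuityZ3.Theorems.Transplant.SkelNegBParamsLFA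
import Summits.CriticalPhenomena.PercolationContinuityZ3.Theorems.Transplant.PlanarSkeletonFrmQuasiDefs
import Summits.CriticalPhenomena.PercolationContinuityZ3.Theorems.Transplant.PlanarSkeletonFrmDefs
import Summits.CriticalPhenomena.PercolationContinuityZ3.Theorems.Transplant.SkelPhiStepIDataNS
import Summits.CriticalPhenomena.PercolationContinuityZ3.Theorems.Transplant.SkelFrmQuasi1ParamsLBL
import Summits.CriticalPhenomena.PercolationContinuityZ3.Theorems.Transplant.SkelFrmQuasi1ParamsPO
import Summits.CriticalPhenomena.PercolationContinuityZ3.Theorems.Transplant.SkelNegParamsFineAQ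
import HarnessLib
import Summits.CriticalPhenomena.PercolationContinuityZ3.Theorems.Transplant.SkelFrmBParamsLFA
/-!
# GEN-Q PORT (WAVE-Q table v0.8 section 2, row G025, U-level L5; captain R-6/R-7 2026-08-27: carrier token swap `PlanarSkeletonFrmFrom ↦ PlanarSkeletonFrmQuasi`)
# of the tree module «Transplant/SkelFrmFromBParamsLFA» (sha256 e5558e61e5a92b1f…) onto the quasi-step carrier `PlanarSkeletonFrmQuasi` (p507026): «SkelFrmQuasiBParamsLFA»

ORIGINAL TITLE: N2 (frames-only node `SamePDropOfSkeletonFrm₁`, OPEN) params column over `PlanarSkeletonFrm` — (ζ″) ledger, shape (B′) of record ((R-14)):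

builds on p205010 (kernel theorem, internal audit signed; external expert review pending) — nothing in this file uses p205010; NOTHING is claimed about any open node
((N3-b), the end state).  Lane `prim-bschramm`, seat `prim-bschramm-stmt` (gen 33; GEN-Q column pen; tool = captain gen-1 g4's port_genq.py R-14 --cone + p3-g30's T1 patch).  Helper file (`--supports stmt-CriticalPhenomena-4575 --as helper`).
PORT RULES (U-wave r1–r4 re-used, GEN-Q hunk classes of p3-g29 #6136): declaration order, names and proof texts are those of «SkelFrmFromBParamsLFA», byte-identical except
(i) the carrier token `PlanarSkeletonFrmFrom ↦ PlanarSkeletonFrmQuasi` in binders, `namespace`/`end` lines and qualified names (module names `SkelFrmFrom… ↦ SkelFrmQuasi…`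
in imports of already-ported rows); (ii) `Φ.step ↦ Φ.qstep` with the called Steps lemma replaced by its `…Q`/`_q` twin and the cost `Φ.M` threaded (none in this file unless
listed below); (iii) `Φ.cyl_connected ↦ Φ.cyl_reach` readers (none unless listed); (iv) graph-ball radii / window floors ×`Φ.M` (none unless listed).  Carrier-free
residents stay imported/exported from the original «SkelFrmBParamsLFA» exactly as in the FrmFrom port.  Docstrings and citations are the original's.

-/

noncomputable section

open scoped Classical

namespace Summit.CriticalPhenomena.PercolationContinuityZ3.Theorems.Transplant

namespace PlanarSkeletonFrmQuasi

namespace NegB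

open Literature.Probability.Percolation Literature.Probability.LatticeModels SimpleGraph
open Literature.Barriers.CriticalPhenomena (graphBall)
open SkelConc (Consts)
open Neg

/-! ## §0 The coarse-lattice constant of the (ζ′) chain -/

export PlanarSkeletonNeg.NegB (Aof)

export PlanarSkeletonNeg.NegB (Aof_eq_K)

export PlanarSkeletonNeg.NegB (Aof_eq_Kq)

export PlanarSkeletonNeg.NegB (le_Aof)

export PlanarSkeletonNeg.NegB (Aof_pos)

/-! ## §0b The length budgets of the NOWL closure (p3-g11 02:53:30Z / 03:03:22Z) -/

export PlanarSkeletonNeg.NegB (LfA)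

export PlanarSkeletonNeg.NegB (LfA_eq)

export PlanarSkeletonNeg.NegB (nmaxCA)

export PlanarSkeletonNeg.NegB (nmaxCA_eq)

export PlanarSkeletonNeg.NegB (nmaxCA_le_LfA)

export PlanarSkeletonNeg.NegB (nFA)

export PlanarSkeletonNeg.NegB (nFA_le_LfA)

export PlanarSkeletonNeg.NegB (LfA_ge)

section LFLevel

/-! ## §1 The cells of record at `A := Aof κ` -/

/-- The maximal fine multiplier of axis `0` at `A`: `m₀^A := mOfA₀ A K n_L h_L ℓ_L v_L`. [this work] -/
def m0A (κ : Consts) {V : Type} [DecidableEq V] [Countable V] {G : SimpleGraph V} [G.LocallyFinite] (Φ : PlanarSkeletonFrmQuasi G) (t : V) (p : unitInterval) (D : Skelφ.StepI.DataNS V) (g : ℕ) (f : ℕ) : ℤ := Skelφ.NegPrm.mOfA₀ (Aof κ) (Neg.K κ) (nL κ Φ t p D g f) (hL κ Φ t p D g f) (ℓL κ Φ t p D g f) (vL κ Φ t p D g f)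

/-- The maximal fine multiplier of axis `1` at `A`: `m₁^A := mOfA₁ A K n_L h_L ℓ_L v_L`. [this work] -/
def m1A (κ : Consts) {V : Type} [DecidableEq V] [Countable V] {G : SimpleGraph V} [G.LocallyFinite] (Φ : PlanarSkeletonFrmQuasi G) (t : V) (p : unitInterval) (D : Skelφ.StepI.DataNS V) (g : ℕ) (f : ℕ) : ℤ := Skelφ.NegPrm.mOfA₁ (Aof κ) (Neg.K κ) (nL κ Φ t p D g f) (hL κ Φ t p D g f) (ℓL κ Φ t p D g f) (vL κ Φ t p D g f)

/-- **'Kq dropped from the divisor'**: `m₀^A = ⌊modulus/L̂₀⌋`, `m₁^A = ⌊modulus/L̂₁⌋`. [this work] -/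
theorem mA_eq (κ : Consts) {V : Type} [DecidableEq V] [Countable V] {G : SimpleGraph V} [G.LocallyFinite] (Φ : PlanarSkeletonFrmQuasi G) (t : V) (p : unitInterval) (D : Skelφ.StepI.DataNS V) (g : ℕ) (f : ℕ) : m0A κ Φ t p D g f =
      TwoAxis.Para.modulus (nL κ Φ t p D g f) (hL κ Φ t p D g f) (vL κ Φ t p D g f) (vβL κ Φ t p D g f) /
        Skelφ.NegPrm.L0hat (nL κ Φ t p D g f) (hL κ Φ t p D g f) (ℓL κ Φ t p D g f) (vL κ Φ t p D g f) ∧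
    m1A κ Φ t p D g f =
      TwoAxis.Para.modulus (nL κ Φ t p D g f) (hL κ Φ t p D g f) (vL κ Φ t p D g f) (vβL κ Φ t p D g f) /
        Skelφ.NegPrm.L1hat (nL κ Φ t p D g f) (hL κ Φ t p D g f) :=
  Skelφ.NegPrm.mOfA_eq_of_twentyK (Neg.forty_le_K κ).2.2 (Aof_eq_K κ) _ _ _ _

/-- The fine multiplier of record, axis `0`: `m₀^A − 1`. [this work] -/
def fm0A (κ : Consts) {V : Type} [DecidableEq V] [Countable V] {G : SimpleGraph V} [G.LocallyFinite] (Φ : PlanarSkeletonFrmQuasi G) (t : V) (p : unitInterval) (D : Skelφ.StepI.DataNS V) (g : ℕ) (f : ℕ) : ℤ := m0A κ Φ t p D g f - 1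

/-- The fine multiplier of record, axis `1`: `m₁^A − 1`. [this work] -/
def fm1A (κ : Consts) {V : Type} [DecidableEq V] [Countable V] {G : SimpleGraph V} [G.LocallyFinite] (Φ : PlanarSkeletonFrmQuasi G) (t : V) (p : unitInterval) (D : Skelφ.StepI.DataNS V) (g : ℕ) (f : ℕ) : ℤ := m1A κ Φ t p D g f - 1

/-- The stub increments of record `max 1 (m^A_i − 1).toNat` (`= m^A_i − 1` under the long clause). [this work] -/
def fmNatA (κ : Consts) {V : Type} [DecidableEq V] [Countable V] {G : SimpleGraph V} [G.LocallyFinite] (Φ : PlanarSkeletonFrmQuasi G) (t : V) (p : unitInterval) (D : Skelφ.StepI.DataNS V) (g : ℕ) (f : ℕ) : Fin 2 → ℕ := ![max 1 (fm0A κ Φ t p D g f).toNat, max 1 (fm1A κ Φ t p D g f).toNat]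

/-- **THE TWO-UNIT CELLS OF RECORD OF THE (ζ′) CHAIN** `⟨K, m^A − 1⟩` (one notch below maximal: rounding room). [cite: KozmaNitzan2024, §4 pp. 25–26] -/
def fcellsA (κ : Consts) {V : Type} [DecidableEq V] [Countable V] {G : SimpleGraph V} [G.LocallyFinite] (Φ : PlanarSkeletonFrmQuasi G) (t : V) (p : unitInterval) (D : Skelφ.StepI.DataNS V) (g : ℕ) (f : ℕ) : PCells2 := ⟨Neg.K κ, fmNatA κ Φ t p D g f, (Neg.forty_le_K κ).2.1, fun i => by unfold fmNatA; fin_cases i <;> exact le_max_left _ _⟩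

/-- The cells' `K` is `Neg.K κ` (`κ.K₀ ≤ K`) and `r_i = K·s_i`. [folklore] -/
theorem fcellsA_K (κ : Consts) {V : Type} [DecidableEq V] [Countable V] {G : SimpleGraph V} [G.LocallyFinite] (Φ : PlanarSkeletonFrmQuasi G) (t : V) (p : unitInterval) (D : Skelφ.StepI.DataNS V) (g : ℕ) (f : ℕ) : (fcellsA κ Φ t p D g f).K = Neg.K κ ∧ κ.K₀ ≤ (fcellsA κ Φ t p D g f).K ∧
    ∀ i, (fcellsA κ Φ t p D g f).r i = Neg.K κ * (fcellsA κ Φ t p D g f).s i :=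
  ⟨rfl, Neg.K₀_le_K κ, fun _ => rfl⟩

/-- **`R′ ≤ m^A_i − 1`** at the ledger's values (`le_mOfA_both` at `s := R′ + 1`, floor `4K(R′+1)+2 ≤ M_L`, `800 ≤ A`). [this work] -/
theorem R'_le_fmA_at (κ : Consts) {V : Type} [DecidableEq V] [Countable V] {G : SimpleGraph V} [G.LocallyFinite] (Φ : PlanarSkeletonFrmQuasi G) (t : V) (p : unitInterval) (D : Skelφ.StepI.DataNS V) (g : ℕ) (f : ℕ) (hN : EqNumL κ Φ t p D g f) : (R' κ Φ t p D : ℤ) ≤ fm0A κ Φ t p D g f ∧ (R' κ Φ t p D : ℤ) ≤ fm1A κ Φ t p D g f := by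
  obtain ⟨hn, hℓ, hv, hlay⟩ := hN
  have hM := floor_R'succ κ Φ t p D g
  have h := Skelφ.NegPrm.le_mOfA_both (le_Aof κ) (s := (R' κ Φ t p D : ℤ) + 1) (Neg.forty_le_K κ).2.2 (by positivity) hM hn hℓ hlay hv
  unfold fm0A fm1A m0A m1A
  constructor
  · linarith [h.1]
  · linarith [h.2]

/-- `1 ≤ m^A₀ − 1` and `1 ≤ m^A₁ − 1`. [folklore] -/
theorem one_le_fmA_at (κ : Consts) {V : Type} [DecidableEq V] [Countable V] {G : SimpleGraph V} [G.LocallyFinite] (Φ : PlanarSkeletonFrmQuasi G) (t : V) (p : unitInterval) (D : Skelφ.StepI.DataNS V) (g : ℕ) (f : ℕ) (hN : EqNumL κ Φ t p D g f) : 1 ≤ fm0A κ Φ t p D g f ∧ 1 ≤ fm1A κ Φ t p D g f := by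
  have h := R'_le_fmA_at κ Φ t p D g f hN
  have hR : (1 : ℤ) ≤ R' κ Φ t p D := by exact_mod_cast (one_le_R' κ Φ t p D).1
  exact ⟨hR.trans h.1, hR.trans h.2⟩

/-- **The stub increments ARE `m^A_i − 1`** under the long clause. [folklore] -/
theorem fcellsA_s_at (κ : Consts) {V : Type} [DecidableEq V] [Countable V] {G : SimpleGraph V} [G.LocallyFinite] (Φ : PlanarSkeletonFrmQuasi G) (t : V) (p : unitInterval) (D : Skelφ.StepI.DataNS V) (g : ℕ) (f : ℕ) (hN : EqNumL κ Φ t p D g f) :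
    (((fcellsA κ Φ t p D g f).s 0 : ℕ) : ℤ) = fm0A κ Φ t p D g f ∧ (((fcellsA κ Φ t p D g f).s 1 : ℕ) : ℤ) = fm1A κ Φ t p D g f := by
  obtain ⟨h0, h1⟩ := one_le_fmA_at κ Φ t p D g f hN
  have e0 : (fcellsA κ Φ t p D g f).s 0 = max 1 (fm0A κ Φ t p D g f).toNat := rfl
  have e1 : (fcellsA κ Φ t p D g f).s 1 = max 1 (fm1A κ Φ t p D g f).toNat := rfl
  rw [e0, e1]
  constructor
  · rw [max_eq_right (by omega), Int.toNat_of_nonneg (by omega)]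
  · rw [max_eq_right (by omega), Int.toNat_of_nonneg (by omega)]

/-- **THE (ζ′) UNIT IDENTITY**: the fine resolutions are `c_i = 20K·s_i = A·s_i` — one lattice period reads as `s_i` fine cells. [this work] -/
theorem c_eq_A_mul_s (κ : Consts) {V : Type} [DecidableEq V] [Countable V] {G : SimpleGraph V} [G.LocallyFinite] (Φ : PlanarSkeletonFrmQuasi G) (t : V) (p : unitInterval) (D : Skelφ.StepI.DataNS V) (g : ℕ) (f : ℕ) (i : Fin 2) : 20 * ((fcellsA κ Φ t p D g f).K : ℤ) * (((fcellsA κ Φ t p D g f).s i : ℕ) : ℤ) = Aof κ * (((fcellsA κ Φ t p D g f).s i : ℕ) : ℤ) := by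
  rw [(fcellsA_K κ Φ t p D g f).1, Aof_eq_K]

/-- **The resolution inequalities `c_i·L_i ≤ D_A` for the cells of record** (`c_i = 20K·(m^A_i − 1) ≤ 20K·m^A_i`). [folklore] -/
theorem cL_le_D_fcellsA_at (κ : Consts) {V : Type} [DecidableEq V] [Countable V] {G : SimpleGraph V} [G.LocallyFinite] (Φ : PlanarSkeletonFrmQuasi G) (t : V) (p : unitInterval) (D : Skelφ.StepI.DataNS V) (g : ℕ) (f : ℕ) (hN : EqNumL κ Φ t p D g f) :
    20 * ((fcellsA κ Φ t p D g f).K : ℤ) * (((fcellsA κ Φ t p D g f).s 0 : ℕ) : ℤ) * (|Aof κ| * (|vβL κ Φ t p D g f| + |vL κ Φ t p D g f|)) ≤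
        Skelφ.NegPrm.DofA (Aof κ) (nL κ Φ t p D g f) (hL κ Φ t p D g f) (ℓL κ Φ t p D g f) (vL κ Φ t p D g f) ∧
      20 * ((fcellsA κ Φ t p D g f).K : ℤ) * (((fcellsA κ Φ t p D g f).s 1 : ℕ) : ℤ) * (|Aof κ| * (|(nL κ Φ t p D g f : ℤ)| + |hL κ Φ t p D g f|)) ≤
        Skelφ.NegPrm.DofA (Aof κ) (nL κ Φ t p D g f) (hL κ Φ t p D g f) (ℓL κ Φ t p D g f) (vL κ Φ t p D g f) := by
  obtain ⟨hn1, hℓ1⟩ := one_le_of_eqNumL κ Φ t p D g f hN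
  obtain ⟨e0, e1⟩ := fcellsA_s_at κ Φ t p D g f hN
  have hA := (Aof_pos κ).1
  have hK : (0 : ℤ) ≤ (Neg.K κ : ℤ) := by positivity
  -- the `c_i·L_i ≤ D_A` of the MAXIMAL multipliers, restated with the chain's names (all `rfl`)
  have c0 : 20 * (Neg.K κ : ℤ) * m0A κ Φ t p D g f * (|Aof κ| * (|vβL κ Φ t p D g f| + |vL κ Φ t p D g f|)) ≤
      Skelφ.NegPrm.DofA (Aof κ) (nL κ Φ t p D g f) (hL κ Φ t p D g f) (ℓL κ Φ t p D g f) (vL κ Φ t p D g f) :=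
    Skelφ.NegPrm.cL_le_DA₀ hA (K := Neg.K κ) hn1 hℓ1 (hL κ Φ t p D g f) (vL κ Φ t p D g f)
  have c1 : 20 * (Neg.K κ : ℤ) * m1A κ Φ t p D g f * (|Aof κ| * (|(nL κ Φ t p D g f : ℤ)| + |hL κ Φ t p D g f|)) ≤
      Skelφ.NegPrm.DofA (Aof κ) (nL κ Φ t p D g f) (hL κ Φ t p D g f) (ℓL κ Φ t p D g f) (vL κ Φ t p D g f) :=
    Skelφ.NegPrm.cL_le_DA₁ hA (K := Neg.K κ) hn1 hℓ1 (hL κ Φ t p D g f) (vL κ Φ t p D g f)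
  rw [(fcellsA_K κ Φ t p D g f).1, e0, e1]
  have X0 : (0 : ℤ) ≤ |Aof κ| * (|vβL κ Φ t p D g f| + |vL κ Φ t p D g f|) :=
    mul_nonneg (abs_nonneg _) (add_nonneg (abs_nonneg _) (abs_nonneg _))
  have X1 : (0 : ℤ) ≤ |Aof κ| * (|(nL κ Φ t p D g f : ℤ)| + |hL κ Φ t p D g f|) :=
    mul_nonneg (abs_nonneg _) (add_nonneg (abs_nonneg _) (abs_nonneg _))
  have f0 : fm0A κ Φ t p D g f = m0A κ Φ t p D g f - 1 := rfl
  have f1 : fm1A κ Φ t p D g f = m1A κ Φ t p D g f - 1 := rfl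
  rw [f0, f1]
  constructor
  · nlinarith [c0, mul_nonneg hK X0]
  · nlinarith [c1, mul_nonneg hK X1]

/-- **THE ROUNDING ROOM `c_i·L_i + 2 ≤ D_A` of the cells of record** (one notch: `20K(m^A_i − 1)·A·L̂_i + 20K·A·L̂_i ≤ D_A`, `L̂_i ≥ 1`, `K ≥ 1`, `A ≥ 800`) — the hypothesis of
`fine_rep` / `exists_mem_graphBall_fineSkel_eq` / `hcol_fineSkel`. [this work] -/
theorem room_fcellsA_at (κ : Consts) {V : Type} [DecidableEq V] [Countable V] {G : SimpleGraph V} [G.LocallyFinite] (Φ : PlanarSkeletonFrmQuasi G) (t : V) (p : unitInterval) (D : Skelφ.StepI.DataNS V) (g : ℕ) (f : ℕ) (hN : EqNumL κ Φ t p D g f) :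
    20 * ((fcellsA κ Φ t p D g f).K : ℤ) * (((fcellsA κ Φ t p D g f).s 0 : ℕ) : ℤ) * (|Aof κ| * (|vβL κ Φ t p D g f| + |vL κ Φ t p D g f|)) + 2 ≤
        Skelφ.NegPrm.DofA (Aof κ) (nL κ Φ t p D g f) (hL κ Φ t p D g f) (ℓL κ Φ t p D g f) (vL κ Φ t p D g f) ∧
      20 * ((fcellsA κ Φ t p D g f).K : ℤ) * (((fcellsA κ Φ t p D g f).s 1 : ℕ) : ℤ) * (|Aof κ| * (|(nL κ Φ t p D g f : ℤ)| + |hL κ Φ t p D g f|)) + 2 ≤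
        Skelφ.NegPrm.DofA (Aof κ) (nL κ Φ t p D g f) (hL κ Φ t p D g f) (ℓL κ Φ t p D g f) (vL κ Φ t p D g f) := by
  obtain ⟨hn1, hℓ1⟩ := one_le_of_eqNumL κ Φ t p D g f hN
  obtain ⟨e0, e1⟩ := fcellsA_s_at κ Φ t p D g f hN
  have hK : (1 : ℤ) ≤ (Neg.K κ : ℤ) := by exact_mod_cast (Neg.forty_le_K κ).2.2
  have hA := (Aof_pos κ).1
  have hA8 := le_Aof κ
  have c0 : 20 * (Neg.K κ : ℤ) * m0A κ Φ t p D g f * (|Aof κ| * (|vβL κ Φ t p D g f| + |vL κ Φ t p D g f|)) ≤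
      Skelφ.NegPrm.DofA (Aof κ) (nL κ Φ t p D g f) (hL κ Φ t p D g f) (ℓL κ Φ t p D g f) (vL κ Φ t p D g f) :=
    Skelφ.NegPrm.cL_le_DA₀ hA (K := Neg.K κ) hn1 hℓ1 (hL κ Φ t p D g f) (vL κ Φ t p D g f)
  have c1 : 20 * (Neg.K κ : ℤ) * m1A κ Φ t p D g f * (|Aof κ| * (|(nL κ Φ t p D g f : ℤ)| + |hL κ Φ t p D g f|)) ≤
      Skelφ.NegPrm.DofA (Aof κ) (nL κ Φ t p D g f) (hL κ Φ t p D g f) (ℓL κ Φ t p D g f) (vL κ Φ t p D g f) :=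
    Skelφ.NegPrm.cL_le_DA₁ hA (K := Neg.K κ) hn1 hℓ1 (hL κ Φ t p D g f) (vL κ Φ t p D g f)
  rw [(fcellsA_K κ Φ t p D g f).1, e0, e1]
  have eA : |Aof κ| = Aof κ := abs_of_pos hA
  have hL0 : (1 : ℤ) ≤ |vβL κ Φ t p D g f| + |vL κ Φ t p D g f| := one_le_L0 hn1 hℓ1 _ _
  have hL1 : (1 : ℤ) ≤ |(nL κ Φ t p D g f : ℤ)| + |hL κ Φ t p D g f| := by
    rw [abs_of_nonneg (by positivity : (0 : ℤ) ≤ (nL κ Φ t p D g f : ℤ))]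
    have : (1 : ℤ) ≤ nL κ Φ t p D g f := by exact_mod_cast hn1
    linarith [abs_nonneg (hL κ Φ t p D g f)]
  rw [eA] at c0 c1 ⊢
  have f0 : fm0A κ Φ t p D g f = m0A κ Φ t p D g f - 1 := rfl
  have f1 : fm1A κ Φ t p D g f = m1A κ Φ t p D g f - 1 := rfl
  rw [f0, f1]
  -- `20K(m − 1)·A·L + 2 ≤ 20K·m·A·L ≤ D_A` since `20K·A·L ≥ 20·800·1 ≥ 2`
  have hAL0 : 2 ≤ 20 * (Neg.K κ : ℤ) * (Aof κ * (|vβL κ Φ t p D g f| + |vL κ Φ t p D g f|)) := by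
    have h1 : (1 : ℤ) * (800 * 1) ≤ (Neg.K κ : ℤ) * (Aof κ * (|vβL κ Φ t p D g f| + |vL κ Φ t p D g f|)) :=
      mul_le_mul hK (mul_le_mul hA8 hL0 (by norm_num) hA.le) (by norm_num) (by linarith)
    linarith
  have hAL1 : 2 ≤ 20 * (Neg.K κ : ℤ) * (Aof κ * (|(nL κ Φ t p D g f : ℤ)| + |hL κ Φ t p D g f|)) := by
    have h1 : (1 : ℤ) * (800 * 1) ≤ (Neg.K κ : ℤ) * (Aof κ * (|(nL κ Φ t p D g f : ℤ)| + |hL κ Φ t p D g f|)) :=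
      mul_le_mul hK (mul_le_mul hA8 hL1 (by norm_num) hA.le) (by norm_num) (by linarith)
    linarith
  constructor
  · nlinarith [c0, hAL0]
  · nlinarith [c1, hAL1]

/-! ## §2 The fine window map of the (ζ′) chain (map slot `φ′`) -/

/-- **THE FINE WINDOW MAP OF THE (ζ′) CHAIN AT THE LEDGER'S VALUES**, planar map a slot: `fineA φ′ := NegPrm.fineA φ′ t A fcellsA n_L h_L ℓ_L v_L`. [this work] -/
def fineA (κ : Consts) {V : Type} [DecidableEq V] [Countable V] {G : SimpleGraph V} [G.LocallyFinite] (Φ : PlanarSkeletonFrmQuasi G) (t : V) (p : unitInterval) (D : Skelφ.StepI.DataNS V) (g : ℕ) (f : ℕ) (φ' : V → Site 2) : V → Site 2 :=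
  Skelφ.NegPrm.fineA φ' t (Aof κ) (fcellsA κ Φ t p D g f) (nL κ Φ t p D g f) (hL κ Φ t p D g f) (ℓL κ Φ t p D g f) (vL κ Φ t p D g f)

/-- `fineA` unfolded. [folklore] -/
theorem fineA_eq (κ : Consts) {V : Type} [DecidableEq V] [Countable V] {G : SimpleGraph V} [G.LocallyFinite] (Φ : PlanarSkeletonFrmQuasi G) (t : V) (p : unitInterval) (D : Skelφ.StepI.DataNS V) (g : ℕ) (f : ℕ) (φ' : V → Site 2) :
    fineA κ Φ t p D g f φ' = Skelφ.NegPrm.fineA φ' t (Aof κ) (fcellsA κ Φ t p D g f) (nL κ Φ t p D g f) (hL κ Φ t p D g f) (ℓL κ Φ t p D g f) (vL κ Φ t p D g f) :=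
  rfl

/-- **BASE POINT** (`hψ0` of `sepGeomSG₂` at `w₀ = t`): `fineA φ′ t = 0`. [folklore] -/
theorem fineA_base_at (κ : Consts) {V : Type} [DecidableEq V] [Countable V] {G : SimpleGraph V} [G.LocallyFinite] (Φ : PlanarSkeletonFrmQuasi G) (t : V) (p : unitInterval) (D : Skelφ.StepI.DataNS V) (g : ℕ) (f : ℕ) (φ' : V → Site 2) (hN : EqNumL κ Φ t p D g f) : fineA κ Φ t p D g f φ' t = 0 := by
  obtain ⟨hn1, hℓ1⟩ := one_le_of_eqNumL κ Φ t p D g f hN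
  exact Skelφ.NegPrm.fineA_base φ' t (Aof_pos κ).2 _ hn1 hℓ1 _ _

/-- **`hlip`**: the fine map is 1-Lipschitz for a 1-Lipschitz `φ′`. [cite: MartineauTassion2017, §4.3] -/
theorem lip_fineA_at (κ : Consts) {V : Type} [DecidableEq V] [Countable V] {G : SimpleGraph V} [G.LocallyFinite] (Φ : PlanarSkeletonFrmQuasi G) (t : V) (p : unitInterval) (D : Skelφ.StepI.DataNS V) (g : ℕ) (f : ℕ) {φ' : V → Site 2} (hlip : Skelφ.Lip G φ') (hN : EqNumL κ Φ t p D g f) : Skelφ.Lip G (fineA κ Φ t p D g f φ') := by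
  obtain ⟨hn1, hℓ1⟩ := one_le_of_eqNumL κ Φ t p D g f hN
  obtain ⟨c0, c1⟩ := cL_le_D_fcellsA_at κ Φ t p D g f hN
  exact Skelφ.NegPrm.lip_fineA hlip t (Aof_pos κ).2 _ hn1 hℓ1 c0 c1

/-- (GEN-Q hand hunk (ii), p3-g30 2026-08-27T09:03:48Z shape: `(hstep : Skelφ.Steps G φ') ↦ {M : ℕ} (hq : Skelφ.QStepsN G φ' M)`, body `weakSteps_fineA ↦ weakSteps_fineA_q` («SkelNegParamsFineAQ»).) **`hws`**: the fine map has weak steps for a unit-step `φ′`. [this work] -/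
theorem weakSteps_fineA_at (κ : Consts) {V : Type} [DecidableEq V] [Countable V] {G : SimpleGraph V} [G.LocallyFinite] (Φ : PlanarSkeletonFrmQuasi G) (t : V) (p : unitInterval) (D : Skelφ.StepI.DataNS V) (g : ℕ) (f : ℕ) {φ' : V → Site 2} {M : ℕ} (hq : Skelφ.QStepsN G φ' M) (hN : EqNumL κ Φ t p D g f) : Skelφ.WeakSteps G (fineA κ Φ t p D g f φ') := by
  obtain ⟨hn1, hℓ1⟩ := one_le_of_eqNumL κ Φ t p D g f hN
  exact Skelφ.NegPrm.weakSteps_fineA_q hq t (Aof_pos κ).2 _ hn1 hℓ1 _ _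

-- GEN-Q (R-2, captain 2026-08-27): `PlanarSkeletonFrmFrom.NegB.fineA_drift_at` is not in the used cone of the node top — not ported.

/-- **A FINE BOX IS A φ′-BOX**: `|Δ fineA|_∞ ≤ r ⇒ 10K·|Δφ′_i| ≤ A·(n_L + ℓ_L + 3|h_L| + 1)·(r + 1)`, i.e. (with `A = 20K`) `|Δφ′_i| ≤ 2·(n_L + ℓ_L + 3|h_L| + 1)·(r + 1)`.
[cite: KozmaNitzan2024, §4 Lemma 12 (p. 24)] -/
theorem φ_extent_fineA_at (κ : Consts) {V : Type} [DecidableEq V] [Countable V] {G : SimpleGraph V} [G.LocallyFinite] (Φ : PlanarSkeletonFrmQuasi G) (t : V) (p : unitInterval) (D : Skelφ.StepI.DataNS V) (g : ℕ) (f : ℕ) (hN : EqNumL κ Φ t p D g f) {φ' : V → Site 2} {w w' : V} {r : ℤ} (hr : 0 ≤ r)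
    (hρ : ∀ i, |fineA κ Φ t p D g f φ' w i - fineA κ Φ t p D g f φ' w' i| ≤ r) (i : Fin 2) :
    10 * (Neg.K κ : ℤ) * |φ' w i - φ' w' i| ≤ Aof κ * ((nL κ Φ t p D g f : ℤ) + ℓL κ Φ t p D g f + 3 * |hL κ Φ t p D g f| + 1) * (r + 1) ∧
      |φ' w i - φ' w' i| ≤ 2 * ((nL κ Φ t p D g f : ℤ) + ℓL κ Φ t p D g f + 3 * |hL κ Φ t p D g f| + 1) * (r + 1) := by
  obtain ⟨hn1, hℓ1⟩ := one_le_of_eqNumL κ Φ t p D g f hN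
  obtain ⟨-, -, hv, -⟩ := hN
  have h := Skelφ.NegPrm.φ_extent_of_fineA_extent t (Aof_pos κ).1 _ hn1 hℓ1 _ hv hr hρ i
  have hKf : ((fcellsA κ Φ t p D g f).K : ℤ) = (Neg.K κ : ℤ) := by rw [(fcellsA_K κ Φ t p D g f).1]
  rw [hKf] at h
  refine ⟨h, ?_⟩
  rw [Aof_eq_K] at h
  have hK : (0 : ℤ) < (Neg.K κ : ℤ) := by exact_mod_cast (Neg.forty_le_K κ).2.2
  have e : 20 * (Neg.K κ : ℤ) * (((nL κ Φ t p D g f : ℤ) + ℓL κ Φ t p D g f + 3 * |hL κ Φ t p D g f| + 1) * (r + 1)) * 1 =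
      10 * (Neg.K κ : ℤ) * (2 * ((nL κ Φ t p D g f : ℤ) + ℓL κ Φ t p D g f + 3 * |hL κ Φ t p D g f| + 1) * (r + 1)) := by ring
  have h' : 10 * (Neg.K κ : ℤ) * |φ' w i - φ' w' i| ≤ 10 * (Neg.K κ : ℤ) * (2 * ((nL κ Φ t p D g f : ℤ) + ℓL κ Φ t p D g f + 3 * |hL κ Φ t p D g f| + 1) * (r + 1)) := by
    linarith
  exact le_of_mul_le_mul_left h' (by linarith)

/-! ## §3 The column radius, FINE STEPS, and the column point `hcol` -/

/-- **The column radius of record** `NrepA z := ‖rep₂ z‖₁` at lattice constant `A` and the resolutions of `fcellsA`. [this work] -/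
def NrepA (κ : Consts) {V : Type} [DecidableEq V] [Countable V] {G : SimpleGraph V} [G.LocallyFinite] (Φ : PlanarSkeletonFrmQuasi G) (t : V) (p : unitInterval) (D : Skelφ.StepI.DataNS V) (g : ℕ) (f : ℕ) (z : Site 2) : ℕ :=
  (TwoAxis.Para.rep₂ (Aof κ) (nL κ Φ t p D g f) (hL κ Φ t p D g f) (vL κ Φ t p D g f) (vβL κ Φ t p D g f)
      (20 * ((fcellsA κ Φ t p D g f).K : ℤ) * (((fcellsA κ Φ t p D g f).s 0 : ℕ) : ℤ)) (20 * ((fcellsA κ Φ t p D g f).K : ℤ) * (((fcellsA κ Φ t p D g f).s 1 : ℕ) : ℤ)) z 0).natAbs +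
    (TwoAxis.Para.rep₂ (Aof κ) (nL κ Φ t p D g f) (hL κ Φ t p D g f) (vL κ Φ t p D g f) (vβL κ Φ t p D g f)
      (20 * ((fcellsA κ Φ t p D g f).K : ℤ) * (((fcellsA κ Φ t p D g f).s 0 : ℕ) : ℤ)) (20 * ((fcellsA κ Φ t p D g f).K : ℤ) * (((fcellsA κ Φ t p D g f).s 1 : ℕ) : ℤ)) z 1).natAbs

/-- The resolutions of the cells of record are positive. [folklore] -/
theorem cA_pos (κ : Consts) {V : Type} [DecidableEq V] [Countable V] {G : SimpleGraph V} [G.LocallyFinite] (Φ : PlanarSkeletonFrmQuasi G) (t : V) (p : unitInterval) (D : Skelφ.StepI.DataNS V) (g : ℕ) (f : ℕ) (i : Fin 2) : (0 : ℤ) < 20 * ((fcellsA κ Φ t p D g f).K : ℤ) * (((fcellsA κ Φ t p D g f).s i : ℕ) : ℤ) := by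
  have hK : (1 : ℤ) ≤ ((fcellsA κ Φ t p D g f).K : ℤ) := by rw [(fcellsA_K κ Φ t p D g f).1]; exact_mod_cast (Neg.forty_le_K κ).2.2
  have hs : (1 : ℤ) ≤ (((fcellsA κ Φ t p D g f).s i : ℕ) : ℤ) := by exact_mod_cast (fcellsA κ Φ t p D g f).hs i
  nlinarith

-- GEN-Q (R-2, captain 2026-08-27): `PlanarSkeletonFrmFrom.NegB.exists_fineA_eq_at` is not in the used cone of the node top — not ported.

-- GEN-Q (R-2, captain 2026-08-27): `PlanarSkeletonFrmFrom.NegB.hcol_fineA_at` is not in the used cone of the node top — not ported.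

-- GEN-Q (R-2, captain 2026-08-27): `PlanarSkeletonFrmFrom.NegB.hcol_fineA_of_sched` is not in the used cone of the node top — not ported.

end LFLevel

end NegB

end PlanarSkeletonFrmQuasi

end Summit.CriticalPhenomena.PercolationContinuityZ3.Theorems.Transplant

end
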